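import Literature.MathematicalPhysics.QuantumLattice.HubbardOneParticleCost
import Summits.HubbardSuperconductivity.HubbardSuperconductivity.Theorems.JosephsonMirrorJmCuspSectorGap
import HarnessLib

/-!
# Stub `stub_sectorLipschitz` of line `sector-invisible-dressing`
# (crux `WindowGap`, item stmt-HubbardSuperconductivity-1088, route KacWindowPenalty)

A VOLUME-UNIFORM Lipschitz bound of the `N`-particle ground-state energies
`E(N) = groundEnergyAt (fermionTorusGraph 2 L) 1 U N` of the Hubbard Hamiltonian
`hubbardTorus 2 L 1 U` on the `L × L` torus around a filling `2n` with `2n ≤ L² ≤ 8n`: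

  `E(2n) ≤ E(N) + 144 (2 + |U|) · |N − 2n|`  for every `N ≤ 2L²`.

Proof (all ingredients are in the Literature tree). On a finite graph of maximal degree `≤ Δ` the
one-particle costs of `HubbardOneParticleCost.lean` read, with `K = (2Δ+1) · 2 (2|t| + |U|)`,
`E(M+1) ≤ E(M) + K · 2|Λ| / (2|Λ| − M)` (`ThermodynamicLimit.groundEnergyAt_succ_le`, `M < 2|Λ|`) and
`E(M−1) ≤ E(M) + K · 2|Λ| / M` (`ThermodynamicLimit.groundEnergyAt_pred_le`, `1 ≤ M ≤ 2|Λ|`).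
Chaining them one particle at a time:
* ADDING `j` particles while staying at most half filled (`M + j ≤ |Λ|`, so each weight
  `2|Λ|/(2|Λ| − M') ≤ 2`) costs at most `2K j` (`groundEnergyAt_add_le_of_le_card`);
* REMOVING `j` particles down to `M ≥ |Λ|/4` (each weight `2|Λ|/M' ≤ 8`) costs at most `8K j`
  (`groundEnergyAt_le_add_of_card_le_four_mul`).
On the torus `Δ = 4` (`SourceGas.card_filter_fermionTorusGraph_adj_le`), `|Λ| = L²`
(`card_fermionTorus`), `t = 1`, so `K = 18 (2 + |U|)` and both constants are `≤ 8K = 144 (2 + |U|)`;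
case on `N ≤ 2n` (add `2n − N ≤ L² − N` particles) / `2n ≤ N` (remove `N − 2n`, floor `2n ≥ L²/4`).

Sources: D. Ruelle, *Statistical Mechanics: Rigorous Results* (1969), §3.4 (a priori bounds and
continuity of thermodynamic functions in the density — the classical analogue); H. Tasaki,
*Physics and Mathematics of Quantum Many-Body Systems* (2020), §2.1 (variational principle in
finite volume). No new definitions. Supports the crux (`--supports stmt-HubbardSuperconductivity-1088`).
-/

-- the mandated namespace `Summit.<Summit>.<Problem>.Theorems` repeats `HubbardSuperconductivity`
-- (single-problem summit, D-0017), which the `dupNamespace` linter flags on every declaration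
set_option linter.dupNamespace false

namespace Summit.HubbardSuperconductivity.HubbardSuperconductivity.Theorems

open Matrix Literature.MathematicalPhysics.QuantumLattice

section Chains

variable {Λ : Type*} [LinearOrder Λ] [Fintype Λ] (G : SimpleGraph Λ) [DecidableRel G.Adj]

/-- **Adding particles below half filling.** On a finite graph of maximal degree `≤ Δ`, with
`K = (2Δ+1) · 2 (2|t| + |U|)`: `E(M + j) ≤ E(M) + 2K · j` whenever `M + j ≤ |Λ|` — the chain of
`j` one-particle addition costs `K · 2|Λ|/(2|Λ| − M') ≤ 2K` at `M' = M, …, M + j − 1 < |Λ|`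
(`ThermodynamicLimit.groundEnergyAt_succ_le`; Ruelle 1969 §3.4). [folklore] -/
theorem groundEnergyAt_add_le_of_le_card {Δ : ℕ}
    (hΔ : ∀ x : Λ, (Finset.univ.filter fun y => G.Adj x y).card ≤ Δ) (t U : ℝ) (M : ℕ) :
    ∀ j : ℕ, M + j ≤ Fintype.card Λ →
      groundEnergyAt G t U (M + j) ≤ groundEnergyAt G t U M +
        2 * (((2 * Δ + 1 : ℕ) : ℝ) * (2 * (2 * |t| + |U|))) * j := by
  have hK0 : (0 : ℝ) ≤ ((2 * Δ + 1 : ℕ) : ℝ) * (2 * (2 * |t| + |U|)) := by positivity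
  set K : ℝ := ((2 * Δ + 1 : ℕ) : ℝ) * (2 * (2 * |t| + |U|))
  intro j
  induction j with
  | zero => intro _; simp
  | succ j ih =>
      intro hj
      have h₁ := ih (by omega)
      -- one more particle at particle number `M + j < |Λ|`
      have h₂ : groundEnergyAt G t U (M + j + 1) ≤ groundEnergyAt G t U (M + j) +
          K * (2 * (Fintype.card Λ : ℝ)) / (2 * (Fintype.card Λ : ℝ) - ((M + j : ℕ) : ℝ)) :=
        ThermodynamicLimit.groundEnergyAt_succ_le G hΔ t U (N := M + j) (by omega)
      -- its weight `2|Λ|/(2|Λ| − (M + j)) ≤ 2`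
      have hle : ((M + j : ℕ) : ℝ) ≤ (Fintype.card Λ : ℝ) := by exact_mod_cast (by omega)
      have hpos : (0 : ℝ) < 2 * (Fintype.card Λ : ℝ) - ((M + j : ℕ) : ℝ) := by
        have : ((M + j : ℕ) : ℝ) < (Fintype.card Λ : ℝ) := by exact_mod_cast (by omega)
        linarith
      have h₃ : K * (2 * (Fintype.card Λ : ℝ)) / (2 * (Fintype.card Λ : ℝ) - ((M + j : ℕ) : ℝ)) ≤
          2 * K := by
        rw [div_le_iff₀ hpos]
        nlinarith [mul_le_mul_of_nonneg_left hle hK0]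
      rw [show M + (j + 1) = M + j + 1 by ring]
      push_cast at h₁ ⊢
      linarith

/-- **Removing particles above quarter filling.** On a finite graph of maximal degree `≤ Δ`, with
`K = (2Δ+1) · 2 (2|t| + |U|)`: `E(M) ≤ E(M + j) + 8K · j` whenever `|Λ| ≤ 4M` and `M + j ≤ 2|Λ|` —
the chain of `j` one-particle removal costs `K · 2|Λ|/M' ≤ 8K` at `M' = M + j, …, M + 1 > |Λ|/4`
(`ThermodynamicLimit.groundEnergyAt_pred_le`; Ruelle 1969 §3.4). [folklore] -/
theorem groundEnergyAt_le_add_of_card_le_four_mul {Δ : ℕ}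
    (hΔ : ∀ x : Λ, (Finset.univ.filter fun y => G.Adj x y).card ≤ Δ) (t U : ℝ) {M : ℕ}
    (hM : Fintype.card Λ ≤ 4 * M) :
    ∀ j : ℕ, M + j ≤ 2 * Fintype.card Λ →
      groundEnergyAt G t U M ≤ groundEnergyAt G t U (M + j) +
        8 * (((2 * Δ + 1 : ℕ) : ℝ) * (2 * (2 * |t| + |U|))) * j := by
  have hK0 : (0 : ℝ) ≤ ((2 * Δ + 1 : ℕ) : ℝ) * (2 * (2 * |t| + |U|)) := by positivity
  set K : ℝ := ((2 * Δ + 1 : ℕ) : ℝ) * (2 * (2 * |t| + |U|))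
  intro j
  induction j with
  | zero => intro _; simp
  | succ j ih =>
      intro hj
      have h₁ := ih (by omega)
      -- one particle less at particle number `M + j + 1 > |Λ|/4`
      have h₂ : groundEnergyAt G t U (M + j + 1 - 1) ≤ groundEnergyAt G t U (M + j + 1) +
          K * (2 * (Fintype.card Λ : ℝ)) / ((M + j + 1 : ℕ) : ℝ) :=
        ThermodynamicLimit.groundEnergyAt_pred_le G hΔ t U (N := M + j + 1) (by omega) (by omega)
      rw [Nat.add_sub_cancel] at h₂
      -- its weight `2|Λ|/(M + j + 1) ≤ 8`
      have hle : (Fintype.card Λ : ℝ) ≤ 4 * ((M + j + 1 : ℕ) : ℝ) := by exact_mod_cast (by omega)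
      have hpos : (0 : ℝ) < ((M + j + 1 : ℕ) : ℝ) := by exact_mod_cast (by omega)
      have h₃ : K * (2 * (Fintype.card Λ : ℝ)) / ((M + j + 1 : ℕ) : ℝ) ≤ 8 * K := by
        rw [div_le_iff₀ hpos]
        nlinarith [mul_le_mul_of_nonneg_left hle hK0]
      rw [show M + (j + 1) = M + j + 1 by ring]
      push_cast at h₁ ⊢
      linarith

end Chains

/-- **Stub `stub_sectorLipschitz` of line `sector-invisible-dressing` (crux `WindowGap`,
stmt-HubbardSuperconductivity-1088), by its registered name and signature.** Volume-uniform
Lipschitz bound of the sector ground-state energies `E(N) = groundEnergyAt (fermionTorusGraph 2 L) 1 U N`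
around the filling `2n`, `2n ≤ L² ≤ 8n`: `E(2n) ≤ E(N) + 144 (2 + |U|) · |N − 2n|` for every
`N ≤ 2L²` — add particles one at a time if `N ≤ 2n` (`groundEnergyAt_add_le_of_le_card`, cost
`≤ 2K` each since the chain stays below `L² = |Λ|`) or remove them if `N ≥ 2n`
(`groundEnergyAt_le_add_of_card_le_four_mul`, cost `≤ 8K` each since `2n ≥ L²/4`), with
`K = 18 (2 + |U|)` on the degree-`4` torus at `t = 1`; `8K = 144 (2 + |U|)`. Ruelle (1969) §3.4.
[folklore] -/
theorem stub_sectorLipschitz (L : ℕ) [NeZero L] (U : ℝ) {n N : ℕ} (hn : 2 * n ≤ L ^ 2)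
    (hn' : L ^ 2 ≤ 8 * n) (hN : N ≤ 2 * L ^ 2) :
    groundEnergyAt (fermionTorusGraph 2 L) 1 U (2 * n) ≤
      groundEnergyAt (fermionTorusGraph 2 L) 1 U N + 144 * (2 + |U|) * |(N : ℝ) - 2 * n| := by
  -- degree `≤ 4` on the two-dimensional torus, `|Λ| = L²`, `K = 18 (2 + |U|)` at `t = 1`
  have hΔ : ∀ x : FermionTorus 2 L,
      (Finset.univ.filter fun y => (fermionTorusGraph 2 L).Adj x y).card ≤ 4 :=
    fun x => SourceGas.card_filter_fermionTorusGraph_adj_le x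
  have hV : Fintype.card (FermionTorus 2 L) = L ^ 2 := card_fermionTorus 2 L
  have hK : ((2 * 4 + 1 : ℕ) : ℝ) * (2 * (2 * |(1 : ℝ)| + |U|)) = 18 * (2 + |U|) := by
    rw [abs_one]; push_cast; ring
  have hU : (0 : ℝ) ≤ 2 + |U| := by positivity
  rcases le_total N (2 * n) with hle | hle
  · -- `N ≤ 2n`: add `2n − N` particles, staying below `2n ≤ L²`
    have hle' : (N : ℝ) ≤ 2 * n := by exact_mod_cast hle
    have h := groundEnergyAt_add_le_of_le_card (fermionTorusGraph 2 L) hΔ 1 U N (2 * n - N)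
      (by rw [hV]; omega)
    rw [show N + (2 * n - N) = 2 * n by omega, hK, Nat.cast_sub hle] at h
    push_cast at h
    rw [abs_sub_comm, abs_of_nonneg (sub_nonneg.2 hle')]
    nlinarith [mul_nonneg hU (sub_nonneg.2 hle')]
  · -- `2n ≤ N`: remove `N − 2n` particles, staying above `2n ≥ L²/4`
    have hle' : (2 * n : ℝ) ≤ N := by exact_mod_cast hle
    have h := groundEnergyAt_le_add_of_card_le_four_mul (fermionTorusGraph 2 L) hΔ 1 U
      (M := 2 * n) (by rw [hV]; omega) (N - 2 * n) (by rw [hV]; omega)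
    rw [show 2 * n + (N - 2 * n) = N by omega, hK, Nat.cast_sub hle] at h
    push_cast at h
    rw [abs_of_nonneg (sub_nonneg.2 hle')]
    nlinarith [mul_nonneg hU (sub_nonneg.2 hle')]

end Summit.HubbardSuperconductivity.HubbardSuperconductivity.Theorems
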